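import Literature.AlgebraicGeometry.Modules.SerreTwistHyperplaneClass
import Literature.AlgebraicGeometry.Modules.SerreVanishingTwist
import Literature.AlgebraicGeometry.Modules.SerreTwistSum
import Literature.AlgebraicGeometry.Morphisms.CechModuleCoverIndependence
import Literature.AlgebraicGeometry.Motives.AmpleDivisorVeryAmpleMultiple
import Literature.AlgebraicGeometry.Modules.TensorSheafHomIso
import Literature.AlgebraicGeometry.Modules.Biduality
import Literature.AlgebraicGeometry.Modules.DetClassTensor
import Literature.AlgebraicGeometry.Modules.AffineVectorBundleSections
import Literature.AlgebraicGeometry.Modules.VanishingLocusFiniteLocallyFree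
import Literature.AlgebraicGeometry.HodgeTheory.AppellHumbertFormOfPhiPic
import HarnessLib

/-!
# Serre's vanishing theorem for the multiples of an ample Cartier divisor:
# `Ȟ¹(𝒰; 𝒪_X(m • Θ)) = 0` for `m ≫ 0` on every finite affine open cover

Layer `Literature/AlgebraicGeometry/Modules`; theorems only (no `def`, no instance, no notation, no named fact, no `sorry`).

[Hartshorne1977] III Thm. 5.2 (b) (Serre): «Let `X` be a projective scheme over a noetherian ring `A`, `𝒪_X(1)` a very ample
invertible sheaf, `ℱ` coherent. Then `Hⁱ(X, ℱ(n)) = 0` for all `i > 0` and `n ≫ 0`»; with II Thm. 7.6 («`𝓛` ample ⟹ `𝓛^m` very ample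
for some `m > 0`») this gives, for an AMPLE Cartier divisor `Θ` on an integral proper `k`-scheme `X`: `H¹(X, 𝒪_X(m • Θ)) = 0` for all
large `m` ([Hartshorne1977] III Prop. 5.3; [GortzWedhorn2023] Thm. 23.14 / Prop. 27.? «ample ⟹ cohomologically ample»).

This file PROVES the degree-one statement in the cell's Čech dialect (`Morphisms/CechModule.CechMH1 f M 𝒰`, any finite affine open
cover `𝒰`), for the line bundles `Modules.lineBundle (m • Θ).toUnitCocycle` of the Cartier-divisor model (`Motives/CartierDivisor`):

* **`exists_forall_subsingleton_cechMH1_lineBundle_nsmul`**: for `X : SchemeOver k` integral and proper over a field, `Θ` ample and a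
  finite affine open cover `U`, `∃ N, ∀ m ≥ N, Subsingleton (CechMH1 X.hom (Modules.lineBundle (m • Θ).toUnitCocycle) U)`.

Road (every step ★ in the tree): ★ `CartierDivisor.IsAmple.exists_smul_linEquiv_divisor` (`q ≥ 1`, a closed immersion
`ι : X ↪ ℙⁿ_k` with `q • Θ ∼ H_ι`, `H_ι` the hyperplane divisor of `GeneratingSections.ofHom ι`); write `m = a q + r`, `r < q`, and put
`G_r := 𝒪_X(r • Θ)` (rank one, coherent); Serre's theorems A and vanishing in the ProjCech dialect (★ `SerreTwist.exists_generators`, ★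
`SerreTwist.exists_forall_subsingleton_cechMH1_twistMod`: `Ȟ¹(cover ι; G_r(a)) = 0` for `a ≥ d₀(r)`) on the twists
`G_r(a) = twistMod ι G_r a ≅ 𝓗om(𝒪_X(-a), G_r)` (★ `sheafHomTwistIso`); then `𝓗om(𝒪_X(-a), G_r) ≅ 𝒪_X(-a)^∨ ⊗ G_r` (§1
`nonempty_sheafHom_iso_tensorObj_dual`: biduality ★ `isIso_toBidual` + ★ `tensorSheafHomDualIso`), `𝒪_X(-a)^∨ ≅ 𝒪_X(a • H_ι)` (★ THE TWIST
DICTIONARY `SerreTwist.nonempty_dual_serreTwist_iso_lineBundle` of `Modules/SerreTwistHyperplaneClass`), and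
`𝒪(a • H_ι) ⊗ 𝒪(r • Θ) ≅ 𝒪((a q + r) • Θ)` (§1 `nonempty_tensorObj_lineBundle_iso_lineBundle`: rank-one modules are classified by their
class, ★ `nonempty_iso_iff_detClass_eq`, ★ `detClass_tensorObj_of_hasRank_one`, ★ `cechClass_nsmul`, ★ `LinEquiv.cechClass_eq`);
finally `N := q · max_{r<q} d₀(r)`, the structure morphism `strZ ι = X.hom` (`Over.w`) and cover independence for the affine-localizing
`𝒪(m • Θ)` (★ `subsingleton_cechMH1_iff_of_isAffineOpen`).

Consumer: V3 of the cell's F-2 (b) field-case line — `H¹(A, 𝒪(Θ)) = 0` for a symmetric ample `Θ` on an abelian variety over any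
field (★ `AbelianVariety.subsingleton_cechMH1_lineBundle_of_symmetric_of_forall_nsmul`, hypothesis `hvan` = this file's conclusion),
hence the fibrewise `H¹`-vanishing `hvan` of the (h2)/(h6) base-change chain.  Cell hodgecm-mathlib; count-neutral Literature capital.
HC_CM is proved only modulo the printed citations until rung 0 closes; this file discharges none of them.

## References
* [Hartshorne1977] R. Hartshorne, *Algebraic Geometry*, GTM 52 (1977): II Thm. 7.6 (p. 154); III Thm. 5.2 (b) (p. 228), III Prop. 5.3
  (p. 229); II Ex. 5.1 (a), (b) (p. 123) (biduality, `𝓗om(E^∨, F) ≅ E ⊗ F`); II Ex. 6.11, III Ex. 4.5 (rank-one modules and their classes).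
* [GortzWedhorn2020] U. Görtz, T. Wedhorn, *Algebraic Geometry I*, 2nd ed. (2020): Prop. 11.21 (p. 302), Thm. 13.59 (2) (p. 503).
-/

noncomputable section

set_option backward.isDefEq.respectTransparency false

open CategoryTheory AlgebraicGeometry TopologicalSpace Opposite
open Literature.Algebra.Homology Literature.Algebra.Homology.LaurentCech
open Literature.AlgebraicGeometry.Morphisms Literature.AlgebraicGeometry.Morphisms.ProjCech
open Literature.AlgebraicGeometry.Motives

universe u v

namespace Literature.AlgebraicGeometry.Modules

section RankOne

variable {X : Scheme.{u}} [IsIntegral X]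

/-- **`𝒪_X(D) ⊗ 𝒪_X(E) ≅ 𝒪_X(F)` as soon as `[𝒪(D)]·[𝒪(E)] = [𝒪(F)]` in `Ȟ¹(X, 𝒪_X^×)`** (rank-one modules are classified by their
determinant class ★ `nonempty_iso_iff_detClass_eq`; ★ `detClass_tensorObj_of_hasRank_one`, ★ `detClass_lineBundle`, ★ `cechClass_eq_mk`).
[cite: Hartshorne1977, II Ex. 6.11 and III Ex. 4.5] [cite: GortzWedhorn2020, Prop. 11.21 (p. 302)] -/
theorem nonempty_tensorObj_lineBundle_iso_lineBundle (D E F : CartierDivisor X)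
    (h : D.cechClass * E.cechClass = F.cechClass) :
    Nonempty (tensorObj (Modules.lineBundle D.toUnitCocycle) (Modules.lineBundle E.toUnitCocycle) ≅
      Modules.lineBundle F.toUnitCocycle) := by
  have hD := D.toUnitCocycle.hasRank_lineBundle
  have hE := E.toUnitCocycle.hasRank_lineBundle
  have hF := F.toUnitCocycle.hasRank_lineBundle
  refine (nonempty_iso_iff_detClass_eq (hasRank_tensorObj_one hD hE) hF
    (isFiniteLocallyFree_tensorObj _ _ D.toUnitCocycle.isFiniteLocallyFree_lineBundle
      E.toUnitCocycle.isFiniteLocallyFree_lineBundle) F.toUnitCocycle.isFiniteLocallyFree_lineBundle).2 ?_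
  rw [detClass_tensorObj_of_hasRank_one hD hE D.toUnitCocycle.isFiniteLocallyFree_lineBundle
      E.toUnitCocycle.isFiniteLocallyFree_lineBundle, UnitCocycle.detClass_lineBundle,
    UnitCocycle.detClass_lineBundle, UnitCocycle.detClass_lineBundle, ← CartierDivisor.cechClass_eq_mk,
    ← CartierDivisor.cechClass_eq_mk, ← CartierDivisor.cechClass_eq_mk, h]

omit [IsIntegral X] in
/-- **`𝓗om(L, G) ≅ L^∨ ⊗ G` for `L` finite locally free**: `𝓗om(L, G) ≅ 𝓗om(L^∨∨, G)` (biduality ★ `isIso_toBidual`, ★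
`sheafHomMapLeftIso`) `≅ L^∨ ⊗ G` (★ `tensorSheafHomDualIso` for the finite locally free `L^∨`). [cite: Hartshorne1977, II Ex. 5.1 (a), (b) (p. 123)] -/
theorem nonempty_sheafHom_iso_tensorObj_dual {L : X.Modules} (hL : IsFiniteLocallyFree L) (G : X.Modules) :
    Nonempty (sheafHom L G ≅ tensorObj (dual L) G) := by
  haveI := isIso_toBidual L hL
  exact ⟨sheafHomMapLeftIso (asIso (toBidual L (unitModule X))) G ≪≫
    (tensorSheafHomDualIso (dual L) G (isFiniteLocallyFree_dual hL)).symm⟩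

end RankOne

/-! ### §2 Serre vanishing for `𝒪_X(m • Θ)`, `Θ` ample -/

section Ample

variable {k : Type u} [Field k] (X : SchemeOver k) [IsIntegral X.left] [IsProper X.hom]

omit [IsProper X.hom] in
/-- **Serre vanishing along one residue class**: for a closed immersion `ι : X ↪ ℙⁿ_k` of `k`-schemes (`X` integral) with `q • Θ ∼ H_ι`
and `r : ℕ`, there is `d₀` with `Ȟ¹(cover ι; 𝒪_X((a q + r) • Θ)) = 0` for all `a ≥ d₀` — Serre's vanishing theorem for the twists
`G_r(a)`, `G_r = 𝒪_X(r • Θ)` (★ `exists_generators`, ★ `exists_forall_subsingleton_cechMH1_twistMod`), transported along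
`G_r(a) ≅ 𝓗om(𝒪(-a), G_r) ≅ 𝒪(-a)^∨ ⊗ G_r ≅ 𝒪(a • H_ι) ⊗ 𝒪(r • Θ) ≅ 𝒪((a q + r) • Θ)` (★ `sheafHomTwistIso`, §1, ★
`SerreTwist.nonempty_dual_serreTwist_iso_lineBundle`, ★ `cechClass_nsmul`, ★ `LinEquiv.cechClass_eq`).
[cite: Hartshorne1977, III Thm. 5.2 (b) (p. 228)] [cite: Hartshorne1977, II Thm. 7.6 (p. 154)] -/
theorem exists_forall_subsingleton_cechMH1_lineBundle_mul_add {n : ℕ} (ι : X ⟶ projectiveSpace n k)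
    [IsClosedImmersion ι.left] (a₀ : Fin (n + 1)) (ha₀ : genericPoint X.left ∈ (GeneratingSections.ofHom ι.left).U a₀)
    (Θ : CartierDivisor X.left) (q : ℕ)
    (hlin : (q • Θ).LinEquiv ((GeneratingSections.ofHom ι.left).divisor a₀ ha₀)) (r : ℕ) :
    ∃ d₀ : ℕ, ∀ a : ℕ, d₀ ≤ a →
      Subsingleton (CechMH1 (strZ ι.left) (Modules.lineBundle ((a * q + r) • Θ).toUnitCocycle) (cover ι.left)) := by
  classical
  set H := (GeneratingSections.ofHom ι.left).divisor a₀ ha₀ with hH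
  set G : X.left.Modules := Modules.lineBundle (r • Θ).toUnitCocycle with hG
  have hGf : IsFiniteLocallyFree G := (r • Θ).toUnitCocycle.isFiniteLocallyFree_lineBundle
  have hGcoh : Coh G :=
    ⟨isAffineLocalizing_of_isFiniteLocallyFree hGf,
      fun _ hV => (finite_projective_sections_of_isFiniteLocallyFree hGf hV).1⟩
  obtain ⟨m₀, hm₀⟩ := SerreTwist.exists_generators ι.left G hGcoh
  obtain ⟨N, g, hgen⟩ := hm₀ m₀ le_rfl
  obtain ⟨d₀, hd₀⟩ := SerreTwist.exists_forall_subsingleton_cechMH1_twistMod ι.left G m₀ g hGcoh.loc hgen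
  refine ⟨d₀, fun a ha => ?_⟩
  -- Serre vanishing for `G(a)`, transported to `𝓗om(𝒪(-a), G)`
  have h1 : Subsingleton (CechMH1 (strZ ι.left) (sheafHom (SerreTwist.serreTwist ι.left a) G) (cover ι.left)) :=
    subsingleton_cechMH1_of_iso (strZ ι.left) (cover ι.left) (SerreTwist.sheafHomTwistIso ι.left G a) (hd₀ a ha)
  -- `𝓗om(𝒪(-a), G) ≅ 𝒪(-a)^∨ ⊗ G ≅ 𝒪(a • H) ⊗ 𝒪(r • Θ) ≅ 𝒪((a q + r) • Θ)`
  obtain ⟨e₁⟩ := nonempty_sheafHom_iso_tensorObj_dual (SerreTwist.isFiniteLocallyFree_serreTwist ι.left a) G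
  obtain ⟨e₂⟩ := SerreTwist.nonempty_dual_serreTwist_iso_lineBundle ι.left a a₀ ha₀
  have hcls : (a • H).cechClass * (r • Θ).cechClass = ((a * q + r) • Θ).cechClass := by
    rw [CartierDivisor.cechClass_nsmul, CartierDivisor.cechClass_nsmul, CartierDivisor.cechClass_nsmul,
      ← hlin.cechClass_eq, CartierDivisor.cechClass_nsmul, ← pow_mul, ← pow_add, mul_comm q a]
  obtain ⟨e₃⟩ := nonempty_tensorObj_lineBundle_iso_lineBundle (a • H) (r • Θ) ((a * q + r) • Θ) hcls
  exact subsingleton_cechMH1_of_iso (strZ ι.left) (cover ι.left)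
    ((e₁ ≪≫ tensorMapIso e₂ (Iso.refl G) ≪≫ e₃).symm) h1

/-- **Serre's vanishing theorem for the multiples of an ample divisor, degree one, Čech form.**  For an integral proper `k`-scheme `X`,
an AMPLE Cartier divisor `Θ` and any finite affine open cover `U` of `X` there is `N` such that `Ȟ¹(𝒰; 𝒪_X(m • Θ)) = 0` for every
`m ≥ N`: some `q • Θ` is the hyperplane divisor of a closed immersion `X ↪ ℙⁿ_k` (★ `IsAmple.exists_smul_linEquiv_divisor`), the
residue classes mod `q` are `exists_forall_subsingleton_cechMH1_lineBundle_mul_add`, `N := q · max_{r<q} d₀(r)`, and the standard cover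
`(X ∩ D₊(x_i))_i` is exchanged for `U` by cover independence (★ `subsingleton_cechMH1_iff_of_isAffineOpen`).
[cite: Hartshorne1977, III Thm. 5.2 (b) (p. 228)] [cite: Hartshorne1977, III Prop. 5.3 (p. 229)] [cite: Hartshorne1977, II Thm. 7.6 (p. 154)] -/
theorem exists_forall_subsingleton_cechMH1_lineBundle_nsmul (Θ : CartierDivisor X.left) (hΘ : Θ.IsAmple)
    {ι : Type v} [Finite ι] (U : ι → X.left.Opens) (hU : ∀ i, IsAffineOpen (U i)) (hcov : ⨆ i, U i = ⊤) :
    ∃ N : ℕ, ∀ m : ℕ, N ≤ m →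
      Subsingleton (CechMH1 X.hom (Modules.lineBundle (m • Θ).toUnitCocycle) U) := by
  classical
  obtain ⟨q, n, ι', hι', a₀, ha₀, hq, hlin⟩ := hΘ.exists_smul_linEquiv_divisor
  haveI := hι'
  choose d₀ hd₀ using exists_forall_subsingleton_cechMH1_lineBundle_mul_add X ι' a₀ ha₀ Θ q hlin
  refine ⟨q * (Finset.range q).sup d₀, fun m hm => ?_⟩
  -- `m = (m / q) q + (m % q)` with `m / q ≥ d₀ (m % q)`
  have hr : m % q < q := Nat.mod_lt _ hq
  have ha : d₀ (m % q) ≤ m / q := by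
    refine le_trans (Finset.le_sup (f := d₀) (Finset.mem_range.mpr hr)) ?_
    exact (Nat.le_div_iff_mul_le hq).mpr (by rw [mul_comm]; exact hm)
  have h := hd₀ (m % q) (m / q) ha
  rw [Nat.div_add_mod' m q] at h
  -- change the structure morphism (`strZ ι'.left = X.hom`) and the cover
  have hstr : strZ ι'.left = X.hom := Over.w ι'
  rw [hstr] at h
  have hM : IsAffineLocalizing (Modules.lineBundle (m • Θ).toUnitCocycle) :=
    isAffineLocalizing_of_isFiniteLocallyFree (m • Θ).toUnitCocycle.isFiniteLocallyFree_lineBundle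
  exact (subsingleton_cechMH1_iff_of_isAffineOpen X.hom hM (cover ι'.left) U
    (fun i => SerreTwist.isAffineOpen_Zop ι'.left (Finset.singleton_nonempty i)) hU (iSup_cover_eq_top ι'.left) hcov).1 h

end Ample

end Literature.AlgebraicGeometry.Modules

end
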